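import Mathlib.Analysis.SpecialFunctions.Gaussian.GaussianIntegral
import Mathlib.Analysis.SpecialFunctions.ImproperIntegrals
import Mathlib.Data.Real.Sign
import Mathlib.MeasureTheory.Integral.IntegralEqImproper
import Literature.MathematicalPhysics.QuantumLattice.LiebRobinsonGaussianFilterProofs
import HarnessLib

/-!
# The Gaussian (error-function) weight of Hastings' quasi-adiabatic continuation

Hastings' original quasi-adiabatic continuation (Phys. Rev. B **69** (2004) 104431, §II, eqs.
(8)–(13); Hastings–Wen, Phys. Rev. B **72** (2005) 045141, §II) dresses an observable `A` across a
spectral gap `γ` of `H` by `A ↦ ∫ w(t) e^{itH} A e^{-itH} dt` with a **Gaussian-filtered** odd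
weight `w`; unlike the exact (compactly Fourier-supported) weight `W_γ` of
Bachmann–Michalakis–Nachtergaele–Sims used in `QuasiAdiabaticWeight.lean`, the Gaussian weight
inverts `ad_H` only *approximately* across the gap — with an error `e^{-γ²/(4a)}` — but decays like
`e^{-at²}` in time, which is what produces the `C log L / L` rate in the higher-dimensional
Lieb–Schultz–Mattis theorem (Hastings 2004; Nachtergaele–Sims, CMP **276** (2007) 437, §2.2, where
the same Gaussian filter enters through `A_a(it, H)` and `B_{a,T}(A, H)`).

This file constructs the weight and PROVES its properties (theorems; two definitions; no named
facts), in exact parallel with `QuasiAdiabaticWeight.lean`: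

* `gqaTail a s = √(a/π) ∫_{y > s} e^{-a y²} dy` (`= ½ erfc(√a s)`): `gqaTail a 0 = 1/2`,
  `(gqaTail a)' = -√(a/π) e^{-a s²}`, `0 ≤ gqaTail a s ≤ ½ e^{-a s²}` for `s ≥ 0` (`a > 0`);
* `gqaWeight a t = sign(t) · gqaTail a |t|` (`= ½ sign(t) erfc(√a |t|)`): odd, measurable,
  `|gqaWeight a t| ≤ ½ e^{-a t²}`, integrable, `∫ |gqaWeight a| ≤ √(π/a)/2`, and Gaussian tails
  `∫_{|t| > T} |gqaWeight a t| dt ≤ e^{-aT²}/(2aT)`;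
* **the Fourier property**: `∫ gqaWeight a t · sin(νt) dt = (1 - e^{-ν²/(4a)})/ν`,
  `∫ gqaWeight a t · cos(νt) dt = 0`, `∫ gqaWeight a t · e^{itν} dt = i (1 - e^{-ν²/(4a)})/ν`
  (`ν ≠ 0`), by integration by parts on `(0, ∞)` and the Gaussian cosine transform
  `∫ cos(νt) e^{-at²} dt = √(π/a) e^{-ν²/(4a)}` (`integral_cos_mul_gaussian` of
  `LiebRobinsonGaussianFilterProofs`). Compared with the exact weight (`i/ν` for `|ν| ≥ γ`), the
  defect `-i e^{-ν²/(4a)}/ν` is what makes the Gaussian dressing an *approximate* intertwiner with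
  error `e^{-γ²/(4a)}` across a gap `γ` (the sibling file on the Gaussian dressing).

## References

* M. B. Hastings, *Lieb–Schultz–Mattis in higher dimensions*, Phys. Rev. B **69** (2004) 104431,
  §II (Gaussian-filtered quasi-adiabatic continuation). [HastingsPRB2004]
* M. B. Hastings, X.-G. Wen, Phys. Rev. B **72** (2005) 045141, §II. [HastingsWen2005]
* B. Nachtergaele, R. Sims, *A multi-dimensional Lieb–Schultz–Mattis theorem*, Comm. Math. Phys.
  **276** (2007) 437–472, §2.2 (eqs. (2.25)–(2.26)) and Lemma 5.5. [NachtergaeleSimsCMP2007]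
* M. B. Hastings, T. Koma, Comm. Math. Phys. **265** (2006) 781, Lemma 14 (the Gaussian filter).
  [HastingsKomaCMP2006]
* Mathlib: `integral_gaussian_Ioi`, `integrable_exp_neg_mul_sq`, `integral_comp_abs`,
  `integral_Ioi_of_hasDerivAt_of_tendsto'`, `Continuous.integral_hasStrictDerivAt`,
  `MeasurePreserving.setIntegral_preimage_emb`; the tree: `integral_cos_mul_gaussian`.
-/

noncomputable section

open Real Complex Set Filter MeasureTheory
open scoped Topology

namespace Literature.MathematicalPhysics.QuantumLattice

/-! ### The Gaussian kernel `√(a/π) e^{-a s²}` and its tail -/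

/-- The tail `G_a(s) = √(a/π) ∫_{y > s} e^{-a y²} dy = ½ erfc(√a s)` of the normalised Gaussian
kernel `√(a/π) e^{-a y²}`. Hastings (2004) §II; Nachtergaele–Sims (2007) §2.2. [folklore] -/
def gqaTail (a s : ℝ) : ℝ := Real.sqrt (a / π) * ∫ y in Ioi s, Real.exp (-a * y ^ 2)

variable {a : ℝ}

/-- The Gaussian kernel is integrable on every right half-line (`a > 0`). [folklore] -/
theorem integrableOn_exp_neg_mul_sq_Ioi (ha : 0 < a) (s : ℝ) :
    IntegrableOn (fun y : ℝ => Real.exp (-a * y ^ 2)) (Ioi s) :=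
  (integrable_exp_neg_mul_sq ha).integrableOn

/-- `√(a/π) · √(π/a) = 1` for `a > 0`. [folklore] -/
theorem sqrt_div_pi_mul_sqrt_pi_div (ha : 0 < a) : Real.sqrt (a / π) * Real.sqrt (π / a) = 1 := by
  rw [← Real.sqrt_mul (div_pos ha pi_pos).le, div_mul_div_comm, mul_comm a π,
    div_self (mul_pos pi_pos ha).ne', Real.sqrt_one]

/-- `G_a(0) = 1/2` (`∫_{y>0} e^{-ay²} dy = √(π/a)/2`, Mathlib `integral_gaussian_Ioi`). [folklore] -/
theorem gqaTail_zero (ha : 0 < a) : gqaTail a 0 = 1 / 2 := by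
  rw [gqaTail, integral_gaussian_Ioi, ← mul_div_assoc, sqrt_div_pi_mul_sqrt_pi_div ha]

/-- `G_a(s) = G_a(0) - √(a/π) ∫₀ˢ e^{-ay²} dy`. [folklore] -/
theorem gqaTail_eq_sub (ha : 0 < a) (s : ℝ) :
    gqaTail a s = gqaTail a 0 -
      Real.sqrt (a / π) * ∫ y in (0:ℝ)..s, Real.exp (-a * y ^ 2) := by
  have h := intervalIntegral.integral_Ioi_sub_Ioi' (integrableOn_exp_neg_mul_sq_Ioi ha 0)
    (integrableOn_exp_neg_mul_sq_Ioi ha s)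
  rw [gqaTail, gqaTail]
  linear_combination -Real.sqrt (a / π) * h

/-- `G_a' = -√(a/π) e^{-a s²}`. [folklore] -/
theorem hasDerivAt_gqaTail (ha : 0 < a) (s : ℝ) :
    HasDerivAt (gqaTail a) (-(Real.sqrt (a / π) * Real.exp (-a * s ^ 2))) s := by
  have hc : Continuous fun y : ℝ => Real.exp (-a * y ^ 2) := by fun_prop
  have h := ((hc.integral_hasStrictDerivAt 0 s).hasDerivAt.const_mul (Real.sqrt (a / π))).const_sub
    (gqaTail a 0)
  have e : gqaTail a = fun u => gqaTail a 0 -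
      Real.sqrt (a / π) * ∫ y in (0:ℝ)..u, Real.exp (-a * y ^ 2) := funext (gqaTail_eq_sub ha)
  rw [e]
  convert h using 1

/-- `G_a` is continuous. [folklore] -/
theorem continuous_gqaTail (ha : 0 < a) : Continuous (gqaTail a) :=
  continuous_iff_continuousAt.2 fun s => (hasDerivAt_gqaTail ha s).continuousAt

/-- `G_a ≥ 0`. [folklore] -/
theorem gqaTail_nonneg (a s : ℝ) : 0 ≤ gqaTail a s :=
  mul_nonneg (Real.sqrt_nonneg _) (setIntegral_nonneg measurableSet_Ioi fun _ _ => (exp_pos _).le)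

/-- **The Gaussian tail bound** `G_a(s) ≤ ½ e^{-a s²}` for `s ≥ 0` (i.e. `erfc(x) ≤ e^{-x²}`):
`∫_{y>s} e^{-ay²} dy = ∫_{u>0} e^{-a(u+s)²} du ≤ e^{-as²} ∫_{u>0} e^{-au²} du` since
`(u+s)² ≥ u² + s²`. [folklore] -/
theorem gqaTail_le (ha : 0 < a) {s : ℝ} (hs : 0 ≤ s) :
    gqaTail a s ≤ 1 / 2 * Real.exp (-a * s ^ 2) := by
  -- translate the half-line `(s, ∞)` to `(0, ∞)`
  have htrans : ∫ y in Ioi s, Real.exp (-a * y ^ 2) = ∫ u in Ioi (0:ℝ), Real.exp (-a * (u + s) ^ 2) := by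
    have h := (measurePreserving_add_right volume s).setIntegral_preimage_emb
      (measurableEmbedding_addRight s) (fun y => Real.exp (-a * y ^ 2)) (Ioi s)
    rw [Set.preimage_add_const_Ioi, sub_self] at h
    exact h.symm
  have hbound : ∀ u ∈ Ioi (0:ℝ), Real.exp (-a * (u + s) ^ 2) ≤
      Real.exp (-a * s ^ 2) * Real.exp (-a * u ^ 2) := by
    intro u hu
    rw [← Real.exp_add]
    refine Real.exp_le_exp.2 ?_
    have hu0 : 0 ≤ u := le_of_lt hu
    nlinarith [mul_nonneg hu0 hs]
  have hint1 : IntegrableOn (fun u : ℝ => Real.exp (-a * (u + s) ^ 2)) (Ioi 0) := by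
    have h := ((measurePreserving_add_right volume s).integrableOn_comp_preimage
      (measurableEmbedding_addRight s)).2 (integrableOn_exp_neg_mul_sq_Ioi ha s)
    rw [Set.preimage_add_const_Ioi, sub_self] at h
    exact h
  have hint2 : IntegrableOn (fun u : ℝ => Real.exp (-a * s ^ 2) * Real.exp (-a * u ^ 2)) (Ioi 0) :=
    (integrableOn_exp_neg_mul_sq_Ioi ha 0).const_mul _
  have hle : ∫ u in Ioi (0:ℝ), Real.exp (-a * (u + s) ^ 2) ≤
      ∫ u in Ioi (0:ℝ), Real.exp (-a * s ^ 2) * Real.exp (-a * u ^ 2) :=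
    setIntegral_mono_on hint1 hint2 measurableSet_Ioi hbound
  rw [integral_const_mul, integral_gaussian_Ioi] at hle
  rw [gqaTail, htrans]
  calc Real.sqrt (a / π) * ∫ u in Ioi (0:ℝ), Real.exp (-a * (u + s) ^ 2)
      ≤ Real.sqrt (a / π) * (Real.exp (-a * s ^ 2) * (Real.sqrt (π / a) / 2)) :=
        mul_le_mul_of_nonneg_left hle (Real.sqrt_nonneg _)
    _ = 1 / 2 * Real.exp (-a * s ^ 2) := by
        have h1 := sqrt_div_pi_mul_sqrt_pi_div ha
        calc Real.sqrt (a / π) * (Real.exp (-a * s ^ 2) * (Real.sqrt (π / a) / 2))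
            = Real.sqrt (a / π) * Real.sqrt (π / a) / 2 * Real.exp (-a * s ^ 2) := by ring
          _ = 1 / 2 * Real.exp (-a * s ^ 2) := by rw [h1]

/-- `|G_a(s)| ≤ ½ e^{-a s²}` for `s ≥ 0`. [folklore] -/
theorem abs_gqaTail_le (ha : 0 < a) {s : ℝ} (hs : 0 ≤ s) :
    |gqaTail a s| ≤ 1 / 2 * Real.exp (-a * s ^ 2) := by
  rw [abs_of_nonneg (gqaTail_nonneg a s)]
  exact gqaTail_le ha hs

/-- `-a s² → -∞` as `s → ∞` (`a > 0`). [folklore] -/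
theorem tendsto_neg_mul_sq_atBot (ha : 0 < a) : Tendsto (fun s : ℝ => -a * s ^ 2) atTop atBot := by
  have h1 : Tendsto (fun s : ℝ => s ^ 2) atTop atTop := tendsto_pow_atTop two_ne_zero
  have h2 := tendsto_neg_atTop_atBot.comp (h1.const_mul_atTop ha)
  refine h2.congr fun s => ?_
  simp only [Function.comp_apply, neg_mul]

/-- `G_a(s) → 0` as `s → ∞`. [folklore] -/
theorem tendsto_gqaTail_atTop (ha : 0 < a) : Tendsto (gqaTail a) atTop (𝓝 0) := by
  have hg : Tendsto (fun s : ℝ => 1 / 2 * Real.exp (-a * s ^ 2)) atTop (𝓝 (1 / 2 * 0)) :=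
    (Real.tendsto_exp_atBot.comp (tendsto_neg_mul_sq_atBot ha)).const_mul _
  rw [mul_zero] at hg
  refine squeeze_zero_norm' ?_ hg
  filter_upwards [eventually_ge_atTop (0:ℝ)] with s hs
  rw [Real.norm_eq_abs]
  exact abs_gqaTail_le ha hs

/-- `G_a` is integrable on `(0, ∞)` (dominated by `½ e^{-as²}`). [folklore] -/
theorem integrableOn_gqaTail_Ioi (ha : 0 < a) : IntegrableOn (gqaTail a) (Ioi 0) := by
  refine Integrable.mono' (((integrableOn_exp_neg_mul_sq_Ioi ha 0).const_mul (1 / 2)))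
    (continuous_gqaTail ha).aestronglyMeasurable ?_
  refine (ae_restrict_iff' measurableSet_Ioi).2 (Eventually.of_forall fun s hs => ?_)
  rw [Real.norm_eq_abs]
  exact abs_gqaTail_le ha (le_of_lt hs)

/-- `∫_{s>0} G_a(s) ds ≤ √(π/a)/4`. [folklore] -/
theorem integral_Ioi_gqaTail_le (ha : 0 < a) :
    ∫ s in Ioi (0:ℝ), gqaTail a s ≤ Real.sqrt (π / a) / 4 := by
  calc ∫ s in Ioi (0:ℝ), gqaTail a s ≤ ∫ s in Ioi (0:ℝ), 1 / 2 * Real.exp (-a * s ^ 2) :=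
        setIntegral_mono_on (integrableOn_gqaTail_Ioi ha)
          ((integrableOn_exp_neg_mul_sq_Ioi ha 0).const_mul (1 / 2)) measurableSet_Ioi
          fun s hs => gqaTail_le ha (le_of_lt hs)
    _ = Real.sqrt (π / a) / 4 := by
        rw [integral_const_mul, integral_gaussian_Ioi]
        ring

/-- Half of the Gaussian cosine transform: `∫_{t>0} e^{-at²} cos(νt) dt = √(π/a) e^{-ν²/(4a)}/2`.
Hastings–Koma (2006) Lemma 14; [folklore] -/
theorem integral_Ioi_exp_neg_mul_sq_mul_cos (ha : 0 < a) (ν : ℝ) :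
    ∫ t in Ioi (0:ℝ), Real.exp (-a * t ^ 2) * Real.cos (ν * t) =
      Real.sqrt (π / a) * Real.exp (-ν ^ 2 / (4 * a)) / 2 := by
  have h := integral_comp_abs (f := fun t => Real.exp (-a * t ^ 2) * Real.cos (ν * t))
  have e : (fun x : ℝ => Real.exp (-a * |x| ^ 2) * Real.cos (ν * |x|)) =
      fun x => Real.cos (ν * x) * Real.exp (-a * x ^ 2) := by
    funext x
    rw [sq_abs, mul_comm]
    rcases le_total 0 x with hx | hx
    · rw [abs_of_nonneg hx]
    · rw [abs_of_nonpos hx, mul_neg, Real.cos_neg]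
  simp only [e, integral_cos_mul_gaussian ha ν] at h
  linarith

/-- **The sine transform of the Gaussian tail** (integration by parts on `(0, ∞)`):
`∫_{t>0} G_a(t) sin(νt) dt = (1 - e^{-ν²/(4a)})/(2ν)` for `ν ≠ 0`. Hastings (2004) §II, eq. (10);
Nachtergaele–Sims (2007) Lemma 5.5. [folklore] -/
theorem integral_Ioi_gqaTail_mul_sin (ha : 0 < a) {ν : ℝ} (hν : ν ≠ 0) :
    ∫ t in Ioi 0, gqaTail a t * Real.sin (ν * t) = (1 - Real.exp (-ν ^ 2 / (4 * a))) / (2 * ν) := by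
  set c : ℝ := Real.sqrt (a / π) with hcdef
  set f : ℝ → ℝ := fun t => -(gqaTail a t * Real.cos (ν * t)) / ν with hf
  set f' : ℝ → ℝ := fun t => gqaTail a t * Real.sin (ν * t) +
    c * Real.exp (-a * t ^ 2) * Real.cos (ν * t) / ν with hf'
  have hderiv : ∀ t ∈ Ici (0:ℝ), HasDerivAt f (f' t) t := by
    intro t _
    have hcos : HasDerivAt (fun y : ℝ => Real.cos (ν * y)) (-Real.sin (ν * t) * (ν * 1)) t :=
      ((hasDerivAt_id t).const_mul ν).cos
    have h := (((hasDerivAt_gqaTail ha t).mul hcos).neg).div_const ν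
    refine h.congr_deriv ?_
    simp only [hf']
    field_simp
    ring
  have hsin_int : IntegrableOn (fun t => gqaTail a t * Real.sin (ν * t)) (Ioi 0) := by
    refine (integrableOn_gqaTail_Ioi ha).mul_bdd (c := 1) (by fun_prop) ?_
    exact Eventually.of_forall fun t => by simpa using Real.abs_sin_le_one (ν * t)
  have hcos_int : IntegrableOn (fun t => c * Real.exp (-a * t ^ 2) * Real.cos (ν * t)) (Ioi 0) := by
    have h1 : IntegrableOn (fun t => Real.exp (-a * t ^ 2) * Real.cos (ν * t)) (Ioi 0) := by
      refine (integrableOn_exp_neg_mul_sq_Ioi ha 0).mul_bdd (c := 1) (by fun_prop) ?_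
      exact Eventually.of_forall fun t => by simpa using Real.abs_cos_le_one (ν * t)
    have e : (fun t => c * Real.exp (-a * t ^ 2) * Real.cos (ν * t)) =
        fun t => c * (Real.exp (-a * t ^ 2) * Real.cos (ν * t)) := funext fun t => by ring
    rw [e]
    exact h1.const_mul c
  have hint : IntegrableOn f' (Ioi 0) := by
    simp only [hf']
    exact hsin_int.add (hcos_int.div_const ν)
  have hlim : Tendsto f atTop (𝓝 0) := by
    have hg : Tendsto (fun t : ℝ => |gqaTail a t| / |ν|) atTop (𝓝 0) := by
      have := ((tendsto_gqaTail_atTop ha).abs).div_const |ν|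
      simpa using this
    refine squeeze_zero_norm (fun t => ?_) hg
    rw [hf, Real.norm_eq_abs, abs_div, abs_neg, abs_mul]
    gcongr
    exact mul_le_of_le_one_right (abs_nonneg _) (Real.abs_cos_le_one _)
  have hFTC := integral_Ioi_of_hasDerivAt_of_tendsto' hderiv hint hlim
  have hf0 : f 0 = -(1 / 2) / ν := by simp [hf, gqaTail_zero ha]
  rw [hf0] at hFTC
  have hsplit : ∫ t in Ioi 0, f' t = (∫ t in Ioi 0, gqaTail a t * Real.sin (ν * t)) +
      (∫ t in Ioi 0, c * Real.exp (-a * t ^ 2) * Real.cos (ν * t)) / ν := by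
    simp only [hf']
    rw [integral_add hsin_int (hcos_int.div_const ν), integral_div]
  have hcosval : ∫ t in Ioi 0, c * Real.exp (-a * t ^ 2) * Real.cos (ν * t) =
      Real.exp (-ν ^ 2 / (4 * a)) / 2 := by
    have e : (fun t => c * Real.exp (-a * t ^ 2) * Real.cos (ν * t)) =
        fun t => c * (Real.exp (-a * t ^ 2) * Real.cos (ν * t)) := funext fun t => by ring
    rw [e, integral_const_mul, integral_Ioi_exp_neg_mul_sq_mul_cos ha ν, hcdef]
    have h1 := sqrt_div_pi_mul_sqrt_pi_div ha
    calc Real.sqrt (a / π) * (Real.sqrt (π / a) * Real.exp (-ν ^ 2 / (4 * a)) / 2)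
        = Real.sqrt (a / π) * Real.sqrt (π / a) * Real.exp (-ν ^ 2 / (4 * a)) / 2 := by ring
      _ = Real.exp (-ν ^ 2 / (4 * a)) / 2 := by rw [h1, one_mul]
  rw [hsplit, hcosval] at hFTC
  field_simp at hFTC ⊢
  linarith

/-! ### The weight `w_a(t) = sign(t) G_a(|t|) = ½ sign(t) erfc(√a |t|)` -/

/-- **The Gaussian quasi-adiabatic weight** `w_a(t) = sign(t) · G_a(|t|) = ½ sign(t) erfc(√a |t|)`:
odd, `|w_a(t)| ≤ ½ e^{-at²}`, with `∫ w_a(t) e^{itν} dt = i (1 - e^{-ν²/(4a)})/ν`. This is the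
time-domain form of Hastings' Gaussian-filtered quasi-adiabatic continuation (Hastings (2004) §II;
Hastings–Wen (2005) §II); it is `-∫₀^∞ (F_t - F_t^*) dt` for the Gaussian filter `F_t` of
Nachtergaele–Sims (2007) eq. (2.25) with `T = ∞`. [cite: HastingsPRB2004, §II] -/
def gqaWeight (a t : ℝ) : ℝ := Real.sign t * gqaTail a |t|

/-- `w_a` is odd. [folklore] -/
theorem gqaWeight_neg (a t : ℝ) : gqaWeight a (-t) = -gqaWeight a t := by
  simp [gqaWeight, Real.sign_neg, abs_neg]

/-- `|w_a(-t)| = |w_a(t)|`. [folklore] -/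
theorem abs_gqaWeight_neg (a t : ℝ) : |gqaWeight a (-t)| = |gqaWeight a t| := by
  rw [gqaWeight_neg, abs_neg]

/-- `w_a = G_a` on `(0, ∞)`. [folklore] -/
theorem gqaWeight_of_pos {t : ℝ} (ht : 0 < t) : gqaWeight a t = gqaTail a t := by
  rw [gqaWeight, Real.sign_of_pos ht, one_mul, abs_of_pos ht]

/-- `w_a(0) = 0`. [folklore] -/
theorem gqaWeight_zero (a : ℝ) : gqaWeight a 0 = 0 := by simp [gqaWeight, Real.sign_zero]

/-- `|w_a(t)| ≤ |G_a(|t|)|`. [folklore] -/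
theorem abs_gqaWeight_le_abs_gqaTail (a t : ℝ) : |gqaWeight a t| ≤ |gqaTail a (|t|)| := by
  rw [gqaWeight, abs_mul]
  rcases Real.sign_apply_eq t with h | h | h <;> simp [h]

/-- **The Gaussian bound on the weight**: `|w_a(t)| ≤ ½ e^{-at²}` (`a > 0`). [folklore] -/
theorem abs_gqaWeight_le (ha : 0 < a) (t : ℝ) : |gqaWeight a t| ≤ 1 / 2 * Real.exp (-a * t ^ 2) := by
  refine (abs_gqaWeight_le_abs_gqaTail a t).trans ?_
  have h := abs_gqaTail_le ha (abs_nonneg t)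
  rwa [sq_abs] at h

/-- The uniform bound `|w_a(t)| ≤ 1/2`. [folklore] -/
theorem abs_gqaWeight_le_half (ha : 0 < a) (t : ℝ) : |gqaWeight a t| ≤ 1 / 2 := by
  refine (abs_gqaWeight_le ha t).trans ?_
  have h : Real.exp (-a * t ^ 2) ≤ 1 := Real.exp_le_one_iff.2 (by nlinarith [sq_nonneg t])
  linarith

/-- `w_a` is measurable. [folklore] -/
theorem measurable_gqaWeight (ha : 0 < a) : Measurable (gqaWeight a) := by
  have hs : Measurable Real.sign := by
    have e : Real.sign = fun r : ℝ => if r < 0 then (-1:ℝ) else if 0 < r then 1 else 0 :=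
      funext fun r => rfl
    rw [e]
    exact Measurable.ite measurableSet_Iio measurable_const
      (Measurable.ite measurableSet_Ioi measurable_const measurable_const)
  exact hs.mul ((continuous_gqaTail ha).measurable.comp continuous_abs.measurable)

/-- `w_a` is integrable (dominated by `½ e^{-at²}`). [folklore] -/
theorem integrable_gqaWeight (ha : 0 < a) : Integrable (gqaWeight a) :=
  ((integrable_exp_neg_mul_sq ha).const_mul (1 / 2)).mono'
    (measurable_gqaWeight ha).aestronglyMeasurable
    (Eventually.of_forall fun t => by rw [Real.norm_eq_abs]; exact abs_gqaWeight_le ha t)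

/-- **The sine transform of `w_a`**: `∫ w_a(t) sin(νt) dt = (1 - e^{-ν²/(4a)})/ν` (`ν ≠ 0`).
Hastings (2004) §II. [folklore] -/
theorem integral_gqaWeight_mul_sin (ha : 0 < a) {ν : ℝ} (hν : ν ≠ 0) :
    ∫ t, gqaWeight a t * Real.sin (ν * t) = (1 - Real.exp (-ν ^ 2 / (4 * a))) / ν := by
  set g : ℝ → ℝ := fun x => Real.sign x ^ 2 * (gqaTail a x * Real.sin (ν * x)) with hg
  have e : ∀ t : ℝ, gqaWeight a t * Real.sin (ν * t) = g |t| := by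
    intro t
    rcases lt_trichotomy t 0 with h | h | h
    · simp only [hg, gqaWeight, abs_of_neg h, Real.sign_of_neg h, Real.sign_of_pos (neg_pos.2 h),
        mul_neg, Real.sin_neg]
      ring
    · subst h; simp [hg, gqaWeight_zero]
    · simp only [hg, gqaWeight, abs_of_pos h, Real.sign_of_pos h]
      ring
  have e2 : ∫ x in Ioi (0:ℝ), g x = ∫ x in Ioi (0:ℝ), gqaTail a x * Real.sin (ν * x) :=
    setIntegral_congr_fun measurableSet_Ioi fun x hx => by
      simp only [hg, Real.sign_of_pos (show 0 < x from hx)]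
      ring
  calc ∫ t, gqaWeight a t * Real.sin (ν * t) = ∫ t, g |t| := by simp_rw [e]
    _ = 2 * ∫ x in Ioi (0:ℝ), g x := integral_comp_abs
    _ = (1 - Real.exp (-ν ^ 2 / (4 * a))) / ν := by
        rw [e2, integral_Ioi_gqaTail_mul_sin ha hν]
        field_simp

/-- The cosine transform of the odd function `w_a` vanishes. [folklore] -/
theorem integral_gqaWeight_mul_cos (a ν : ℝ) : ∫ t, gqaWeight a t * Real.cos (ν * t) = 0 := by
  have h := integral_neg_eq_self (fun t => gqaWeight a t * Real.cos (ν * t)) volume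
  simp only [gqaWeight_neg, mul_neg, Real.cos_neg, neg_mul, integral_neg] at h
  linarith

/-- **The Fourier transform of `w_a`**: `∫ w_a(t) e^{itν} dt = i (1 - e^{-ν²/(4a)})/ν` for `ν ≠ 0`:
the exact inverse `i/ν` of `ad_H` across the gap up to the Gaussian defect `-i e^{-ν²/(4a)}/ν`.
Hastings (2004) §II, eqs. (10)–(13); Nachtergaele–Sims (2007) Lemma 5.5. [folklore] -/
theorem integral_gqaWeight_mul_cexp (ha : 0 < a) {ν : ℝ} (hν : ν ≠ 0) :
    ∫ t, (gqaWeight a t : ℂ) * cexp ((t * ν : ℝ) * I) =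
      I * (1 - Real.exp (-ν ^ 2 / (4 * a))) / ν := by
  have hint := integrable_gqaWeight ha
  have hcos : Integrable fun t => gqaWeight a t * Real.cos (ν * t) :=
    hint.mul_bdd (c := 1) (by fun_prop)
      (Eventually.of_forall fun t => by simpa using Real.abs_cos_le_one (ν * t))
  have hsin : Integrable fun t => gqaWeight a t * Real.sin (ν * t) :=
    hint.mul_bdd (c := 1) (by fun_prop)
      (Eventually.of_forall fun t => by simpa using Real.abs_sin_le_one (ν * t))
  have e : ∀ t : ℝ, (gqaWeight a t : ℂ) * cexp ((t * ν : ℝ) * I) =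
      ((gqaWeight a t * Real.cos (ν * t) : ℝ) : ℂ) +
        ((gqaWeight a t * Real.sin (ν * t) : ℝ) : ℂ) * I := by
    intro t
    rw [Complex.exp_mul_I, ← Complex.ofReal_cos, ← Complex.ofReal_sin, mul_comm t ν]
    push_cast
    ring
  simp_rw [e]
  rw [integral_add (f := fun t => ((gqaWeight a t * Real.cos (ν * t) : ℝ) : ℂ))
    (g := fun t => ((gqaWeight a t * Real.sin (ν * t) : ℝ) : ℂ) * I) hcos.ofReal
    (hsin.ofReal.mul_const I), integral_mul_const, integral_complex_ofReal, integral_complex_ofReal,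
    integral_gqaWeight_mul_cos, integral_gqaWeight_mul_sin ha hν]
  push_cast
  ring

/-! ### `L¹` norm and Gaussian tails of `w_a` -/

/-- **`L¹` bound**: `∫ |w_a| ≤ √(π/a)/2`. [folklore] -/
theorem integral_abs_gqaWeight_le (ha : 0 < a) : ∫ t, |gqaWeight a t| ≤ Real.sqrt (π / a) / 2 := by
  have h := integral_comp_abs (f := fun t => |gqaWeight a t|)
  have e : (fun x : ℝ => |gqaWeight a (|x|)|) = fun x => |gqaWeight a x| := by
    funext x
    rcases le_total 0 x with hx | hx
    · rw [abs_of_nonneg hx]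
    · rw [abs_of_nonpos hx, abs_gqaWeight_neg]
  rw [e] at h
  have h2 : ∫ x in Ioi (0:ℝ), |gqaWeight a x| = ∫ x in Ioi (0:ℝ), gqaTail a x :=
    setIntegral_congr_fun measurableSet_Ioi fun x hx => by
      rw [gqaWeight_of_pos (show 0 < x from hx), abs_of_nonneg (gqaTail_nonneg a x)]
  rw [h, h2]
  have := integral_Ioi_gqaTail_le ha
  linarith

/-- `∫_{t>T} t e^{-at²} dt = e^{-aT²}/(2a)`. [folklore] -/
theorem integral_Ioi_mul_exp_neg_mul_sq (ha : 0 < a) (T : ℝ) :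
    ∫ t in Ioi T, t * Real.exp (-a * t ^ 2) = Real.exp (-a * T ^ 2) / (2 * a) := by
  have hderiv : ∀ t ∈ Ici T, HasDerivAt (fun u : ℝ => -Real.exp (-a * u ^ 2) / (2 * a))
      (t * Real.exp (-a * t ^ 2)) t := by
    intro t _
    have h1 : HasDerivAt (fun u : ℝ => -a * u ^ 2) (-a * (2 * t)) t := by
      simpa using ((hasDerivAt_pow 2 t).const_mul (-a))
    have h2 := (h1.exp.neg).div_const (2 * a)
    refine h2.congr_deriv ?_
    field_simp
  have hint : IntegrableOn (fun t : ℝ => t * Real.exp (-a * t ^ 2)) (Ioi T) :=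
    (integrable_mul_exp_neg_mul_sq ha).integrableOn
  have hlim : Tendsto (fun u : ℝ => -Real.exp (-a * u ^ 2) / (2 * a)) atTop (𝓝 (-0 / (2 * a))) :=
    ((Real.tendsto_exp_atBot.comp (tendsto_neg_mul_sq_atBot ha)).neg).div_const _
  rw [neg_zero, zero_div] at hlim
  rw [integral_Ioi_of_hasDerivAt_of_tendsto' hderiv hint hlim]
  ring

/-- **Gaussian tail on the right half-line**: `∫_{t>T} |w_a(t)| dt ≤ e^{-aT²}/(4aT)` for `T > 0`
(`|w_a(t)| ≤ ½ e^{-at²} ≤ ½ (t/T) e^{-at²}` for `t ≥ T`). [folklore] -/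
theorem integral_Ioi_abs_gqaWeight_le (ha : 0 < a) {T : ℝ} (hT : 0 < T) :
    ∫ t in Ioi T, |gqaWeight a t| ≤ Real.exp (-a * T ^ 2) / (4 * a * T) := by
  have hint2 : IntegrableOn (fun t : ℝ => 1 / (2 * T) * (t * Real.exp (-a * t ^ 2))) (Ioi T) :=
    (integrable_mul_exp_neg_mul_sq ha).integrableOn.const_mul _
  calc ∫ t in Ioi T, |gqaWeight a t| ≤ ∫ t in Ioi T, 1 / (2 * T) * (t * Real.exp (-a * t ^ 2)) := by
        refine setIntegral_mono_on (integrable_gqaWeight ha).abs.integrableOn hint2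
          measurableSet_Ioi fun t ht => ?_
        have ht' : T ≤ t := le_of_lt ht
        have hexp : 0 < Real.exp (-a * t ^ 2) := exp_pos _
        calc |gqaWeight a t| ≤ 1 / 2 * Real.exp (-a * t ^ 2) := abs_gqaWeight_le ha t
          _ ≤ 1 / (2 * T) * (t * Real.exp (-a * t ^ 2)) := by
              rw [show 1 / (2 * T) * (t * Real.exp (-a * t ^ 2)) =
                (t / T) * (1 / 2 * Real.exp (-a * t ^ 2)) by field_simp]
              exact le_mul_of_one_le_left (by positivity) ((one_le_div hT).2 ht')
    _ = Real.exp (-a * T ^ 2) / (4 * a * T) := by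
        rw [integral_const_mul, integral_Ioi_mul_exp_neg_mul_sq ha T]
        field_simp
        ring

/-- Tails on the left half-line equal those on the right (`|w_a|` is even). [folklore] -/
theorem integral_Iic_abs_gqaWeight (a T : ℝ) :
    ∫ t in Iic (-T), |gqaWeight a t| = ∫ t in Ioi T, |gqaWeight a t| := by
  rw [← integral_comp_neg_Ioi]
  simp only [abs_gqaWeight_neg]

/-- **Two-sided Gaussian tails**: `∫_{|t| > T} |w_a(t)| dt ≤ e^{-aT²}/(2aT)` for `T > 0`.
Hastings (2004) §II; Nachtergaele–Sims (2007) Lemma 5.5 (the Gaussian cut-off in time). [folklore] -/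
theorem integral_abs_gqaWeight_tail_le (ha : 0 < a) {T : ℝ} (hT : 0 < T) :
    ∫ t in {t : ℝ | T < |t|}, |gqaWeight a t| ≤ Real.exp (-a * T ^ 2) / (2 * a * T) := by
  have hset : {t : ℝ | T < |t|} = Iio (-T) ∪ Ioi T := by
    ext t
    simp only [mem_setOf_eq, mem_union, mem_Iio, mem_Ioi]
    constructor
    · intro ht
      rcases lt_or_ge t 0 with h0 | h0
      · left; rw [abs_of_neg h0] at ht; linarith
      · right; rwa [abs_of_nonneg h0] at ht
    · rintro (ht | ht)
      · rw [abs_of_neg (by linarith)]; linarith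
      · rwa [abs_of_pos (hT.trans ht)]
  have hint := (integrable_gqaWeight ha).abs
  have hdisj : Disjoint (Iio (-T)) (Ioi T) :=
    Disjoint.mono_left Iio_subset_Iic_self (Iic_disjoint_Ioi (by linarith))
  rw [hset, setIntegral_union hdisj measurableSet_Ioi hint.integrableOn hint.integrableOn,
    ← integral_Iic_eq_integral_Iio, integral_Iic_abs_gqaWeight]
  have h := integral_Ioi_abs_gqaWeight_le ha hT
  calc (∫ t in Ioi T, |gqaWeight a t|) + ∫ t in Ioi T, |gqaWeight a t|
      ≤ Real.exp (-a * T ^ 2) / (4 * a * T) + Real.exp (-a * T ^ 2) / (4 * a * T) := add_le_add h h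
    _ = Real.exp (-a * T ^ 2) / (2 * a * T) := by
        field_simp
        ring

end Literature.MathematicalPhysics.QuantumLattice

end
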